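import Summits.QuantumFields.GaugeBoot.GaugeInvariantBootstrapSymmetry
import Literature.MathematicalPhysics.QuantumFieldTheory.LatticeGaugeStaticPotentialProofs
import HarnessLib

/-!
# Lattice symmetries of the bootstrap II: axis permutations, and the loop equations at ONE LINK (gauge-boot, L1 supplement)

HONEST FRAMING (cell `pub-gaugeboot`, page 1 of every file): the venture produces certified bounds
on lattice expectations at stated coupling, gauge group, dimension and torus size; NOT a mass gap,
NOT a continuum limit, NOT a string tension; NOT Yang–Mills-summit-bearing (barriers
`FixedCouplingUltralocality`, `PerturbativeInvisibility`). Structural; it certifies no number.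

## Content

`BootstrapLatticeSymmetry.lean` treated the translations of the torus `(ℤ/L)^d`: a
translation-invariant bootstrap functional needs the loop equations only at the `d` base links
`(0, i)`. Here the PERMUTATIONS OF THE COORDINATE AXES are added (the tree's `edgePerm σ`,
`(x, i) ↦ (σ·x, σ i)`, an orientation-preserving relabelling of the links, `configPerm`,
`wilsonAction_configPerm`):

* `relabelCM_edgePerm_eq_configPerm`, `wilsonAction_comp_edgePerm` — bookkeeping against the tree;
* ★★ `IsSDFunctional.comp_edgePerm` — relabelling by an axis permutation preserves the loop
  equations (`IsSDFunctional.comp_relabel`);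
* `gaugeTransform_comp_edgePerm`, ★★ `gaugeAvgL_comp_edgePerm` — the gauge average commutes with
  axis permutations; `comp_gaugeAvgL_permInvariant`;
* `exists_translate_edgePerm_base` — every link is `τ_a (σ · (0, 0))`: translations and axis
  permutations act TRANSITIVELY on the positively oriented links;
* ★★★ `isSDFunctional_of_latticeInvariant_oneLink` — a functional invariant on the polynomials
  under all translations and all axis permutations which satisfies the loop equations AT THE SINGLE
  LINK `(0, 0)` satisfies them at every link (any gauge group, Wilson-type compatible local actions);
  ★★★ `eq_wilson_of_bootstrap_oneLink_suN` / `_uN` — `SU(N)` / `U(N)`, ANY real `β`: normalisation +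
  square-positivity + lattice invariance + the loop equations at ONE link ⇒ the functional IS the
  Wilson expectation on every polynomial observable; ★★★
  `eq_wilson_of_gaugeInvariantBootstrap_oneLink_suN` / `_uN` — the same for the bootstrap on
  GAUGE-INVARIANT data (loop positivity + gauge-averaged loop equations at one link);
* `integral_comp_edgePerm_eq_wilson` — consistency: the Wilson expectations ARE permutation
  invariant (tree `wilsonExpectation_comp_configPerm`), so the invariance hypotheses are satisfied
  by the solution and may be imposed on any truncation without losing it.

What this is NOT: reflections (orientation-reversing; sequel), rates, anything at `L → ∞`.

References: P. Anderson, M. Kruczenski, Nucl. Phys. B 921 (2017) §3; V. Kazakov, Z. Zheng,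
arXiv:2203.11360 §3.2 (lattice symmetries of the SDP: loops modulo `B_d ⋉ ℤ^d`, loop equations
modulo symmetry). Folklore.
-/

noncomputable section

open MeasureTheory Filter Topology NormedSpace
open Literature.MathematicalPhysics.QuantumFieldTheory (haarProbability LatticeRep Site Edge GaugeConfig
  plaquetteHolonomy gaugeTransform IsGaugeInvariant wilsonAction wilsonMeasure edgePerm sitePerm
  sitePerm_shift wilsonAction_configPerm configPerm_apply wilsonExpectation_comp_configPerm
  isProbabilityMeasure_wilsonMeasure)

namespace Summit.QuantumFields.GaugeBoot

/-! ## Axis permutations as relabellings of the links -/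

section Torus

variable {d L : ℕ} {G : Type*} [Group G]

/-- `edgePerm σ` evaluated: `(x, i) ↦ (σ·x, σ i)`. -/
@[simp] theorem edgePerm_apply (σ : Equiv.Perm (Fin d)) (e : Edge d L) :
    edgePerm σ e = (sitePerm σ e.1, σ e.2) := rfl

/-- The base link `(0, 0)` goes to the base link `(0, σ 0)`. -/
theorem edgePerm_base [NeZero d] (σ : Equiv.Perm (Fin d)) :
    edgePerm σ (((0 : Site d L)), (0 : Fin d)) = ((0 : Site d L), σ 0) := by
  rw [edgePerm_apply]
  exact Prod.ext (funext fun j => by simp) rfl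

/-- ★ **Transitivity**: every positively oriented link is a translate of an axis-permuted image of
the base link `(0, 0)`: `(x, i) = τ_x (σ_{0i} · (0, 0))`. [folklore] -/
theorem exists_translate_edgePerm_base [NeZero d] (e : Edge d L) :
    ∃ a : Site d L, ∃ σ : Equiv.Perm (Fin d),
      e = translateEquiv a (edgePerm σ (((0 : Site d L)), (0 : Fin d))) :=
  ⟨e.1, Equiv.swap 0 e.2, by
    rw [edgePerm_base, translateEquiv_apply, Equiv.swap_apply_left, zero_add]⟩

variable [TopologicalSpace G]

omit [Group G] in
/-- The relabelling by `edgePerm σ` is the tree's `configPerm σ⁻¹` (`configPerm π U = U ∘ edgePerm π⁻¹`).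
-/
theorem relabelCM_edgePerm_eq_configPerm [MeasurableSpace G] (σ : Equiv.Perm (Fin d)) (U : GaugeConfig d L G) :
    relabelCM (G := G) (edgePerm (L := L) σ) U =
      Literature.MathematicalPhysics.QuantumFieldTheory.configPerm σ.symm U := by
  funext e
  rw [relabelCM_apply, configPerm_apply, Equiv.symm_symm, edgePerm_apply]

variable {N : ℕ} (ρ : G →* Matrix (Fin N) (Fin N) ℂ)

/-- **The Wilson action is invariant under axis permutations** (tree `wilsonAction_configPerm`,
continuous representation of a compact group). -/
theorem wilsonAction_comp_edgePerm [IsTopologicalGroup G] [CompactSpace G] [MeasurableSpace G] [NeZero L]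
    (hρ : Continuous ρ) (σ : Equiv.Perm (Fin d)) (U : GaugeConfig d L G) :
    wilsonAction ρ (U ∘ edgePerm σ) = wilsonAction ρ U := by
  have h := wilsonAction_configPerm (L := L) ρ hρ σ.symm U
  rwa [← relabelCM_edgePerm_eq_configPerm, coe_relabelCM] at h

/-- The constant family of local actions `S_e = S_Wilson` is compatible with the axis permutations. -/
theorem wilsonAction_relabelCM_edgePerm [IsTopologicalGroup G] [CompactSpace G] [MeasurableSpace G] [NeZero L]
    (hρ : Continuous ρ) (σ : Equiv.Perm (Fin d)) (e : Edge d L) (U : GaugeConfig d L G) :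
    (fun _ : Edge d L => wilsonAction ρ) e (relabelCM (G := G) (edgePerm σ) U) =
      (fun _ : Edge d L => wilsonAction ρ) (edgePerm σ e) U :=
  wilsonAction_comp_edgePerm ρ hρ σ U

variable (r : LatticeRep G) {K : Type*} {k : K → ℝ → G} {β : ℝ}

/-- ★★ **Relabelling a Schwinger–Dyson functional by an axis permutation gives a Schwinger–Dyson
functional** (Wilson local actions, continuous `ρ`, compact `G`). [folklore] -/
theorem IsSDFunctional.comp_edgePerm [IsTopologicalGroup G] [CompactSpace G] [MeasurableSpace G] [NeZero L]
    (hρ : Continuous ρ) (σ : Equiv.Perm (Fin d)) {φ : C(GaugeConfig d L G, ℝ) →ₗ[ℝ] ℝ}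
    (hφ : IsSDFunctional r k (fun _ : Edge d L => wilsonAction ρ) β φ) :
    IsSDFunctional r k (fun _ : Edge d L => wilsonAction ρ) β
      (φ ∘ₗ (ContinuousMap.compRightAlgHom ℝ ℝ (relabelCM (G := G) (edgePerm (L := L) σ))).toLinearMap) :=
  hφ.comp_relabel r (edgePerm σ) (wilsonAction_relabelCM_edgePerm ρ hρ σ)

/-! ## The loop equations at one link -/

/-- ★★★ **Reduction of the loop equations to ONE LINK.** Let the local actions be the Wilson action
of a continuous representation of a compact group, `(k_a)` exponential one-parameter families, and
`φ` a linear functional invariant on the polynomial observables under all translations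
`U ↦ U(· + a)` and all axis permutations `U ↦ U ∘ edgePerm σ`. If `φ` satisfies the loop equations
at the single link `(0, 0)`, it satisfies them at every link. [folklore] -/
theorem isSDFunctional_of_latticeInvariant_oneLink [IsTopologicalGroup G] [CompactSpace G] [MeasurableSpace G]
    [NeZero L] [NeZero d] (hρ : Continuous ρ) (hk : ∀ a s t, k a (s + t) = k a s * k a t)
    {X : K → Matrix (Fin r.N) (Fin r.N) ℂ} (hX : ∀ a t, r.ρ (k a t) = exp ((t : ℂ) • X a))
    {φ : C(GaugeConfig d L G, ℝ) →ₗ[ℝ] ℝ}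
    (hφt : ∀ (a : Site d L), ∀ g ∈ polyAlgebra (ι := Edge d L) r,
      φ (g.comp (relabelCM (translateEquiv a))) = φ g)
    (hφp : ∀ (σ : Equiv.Perm (Fin d)), ∀ g ∈ polyAlgebra (ι := Edge d L) r,
      φ (g.comp (relabelCM (edgePerm σ))) = φ g)
    (hrows : IsSDFunctionalAt r {(((0 : Site d L)), (0 : Fin d))} k (fun _ => wilsonAction ρ) β φ) :
    IsSDFunctional r k (fun _ => wilsonAction ρ) β φ := by
  -- the family of relabellings `edgePerm σ` followed by `translateEquiv a`
  refine isSDFunctional_of_invariant_of_rows_at r hk hX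
    (Set.range fun p : Site d L × Equiv.Perm (Fin d) => (edgePerm p.2).trans (translateEquiv p.1))
    ?_ ?_ {(((0 : Site d L)), (0 : Fin d))} ?_ hrows
  · rintro _ ⟨⟨a, σ⟩, rfl⟩ e U
    change wilsonAction ρ (U ∘ ((edgePerm σ).trans (translateEquiv a))) =
      wilsonAction ρ U
    rw [Equiv.coe_trans, ← Function.comp_assoc, wilsonAction_comp_edgePerm ρ hρ,
      wilsonAction_comp_translateEquiv]
  · rintro _ ⟨⟨a, σ⟩, rfl⟩ g hg
    have hsplit : g.comp (relabelCM (G := G) ⇑((edgePerm (L := L) σ).trans (translateEquiv a))) =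
        (g.comp (relabelCM (edgePerm σ))).comp (relabelCM (translateEquiv a)) := by
      ext U; rfl
    rw [hsplit, hφt a _ (comp_relabelCM_mem_polyAlgebra r _ hg), hφp σ g hg]
  · intro e
    obtain ⟨a, σ, he⟩ := exists_translate_edgePerm_base e
    exact ⟨(edgePerm σ).trans (translateEquiv a), ⟨(a, σ), rfl⟩, _, Set.mem_singleton _, he⟩

/-! ## The gauge average commutes with axis permutations -/

omit [TopologicalSpace G] in
/-- **Permuting a gauge-transformed configuration** = gauge transforming the permuted configuration
by the permuted gauge function. -/
theorem gaugeTransform_comp_edgePerm (γ : Site d L → G) (U : GaugeConfig d L G) (σ : Equiv.Perm (Fin d)) :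
    gaugeTransform γ U ∘ edgePerm σ = gaugeTransform (γ ∘ sitePerm σ) (U ∘ edgePerm σ) := by
  funext e
  simp only [Function.comp_apply, edgePerm_apply, gaugeTransform, sitePerm_shift]

variable [IsTopologicalGroup G] [CompactSpace G] [MeasurableSpace G] [BorelSpace G]
  [SecondCountableTopology G] [NeZero L]

/-- ★★ **The gauge average commutes with axis permutations**: `A (f ∘ π_σ) = (A f) ∘ π_σ`. [folklore] -/
theorem gaugeAvgL_comp_edgePerm (f : C(GaugeConfig d L G, ℝ)) (σ : Equiv.Perm (Fin d)) :
    gaugeAvgL d L G (f.comp (relabelCM (edgePerm σ))) =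
      (gaugeAvgL d L G f).comp (relabelCM (edgePerm σ)) := by
  ext U
  rw [ContinuousMap.comp_apply, gaugeAvgL_apply, gaugeAvgL_apply]
  simp only [ContinuousMap.comp_apply, coe_relabelCM]
  simp_rw [gaugeTransform_comp_edgePerm]
  exact integral_comp_equiv_haarProbability_pi (sitePerm σ)
    (F := fun γ : Site d L → G => f (gaugeTransform γ (U ∘ edgePerm σ)))
    (f.continuous.comp (gaugeTransform_action.2.comp (continuous_id.prodMk continuous_const)))

/-- **If `ψ` is permutation invariant on the gauge-invariant polynomials, `ψ ∘ₗ A` is permutation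
invariant on all polynomials.** -/
theorem comp_gaugeAvgL_permInvariant {ψ : C(GaugeConfig d L G, ℝ) →ₗ[ℝ] ℝ}
    (hψ : ∀ (σ : Equiv.Perm (Fin d)), ∀ h ∈ polyAlgebra (ι := Edge d L) r, IsGaugeInvariant (⇑h) →
      ψ (h.comp (relabelCM (edgePerm σ))) = ψ h)
    (σ : Equiv.Perm (Fin d)) {g : C(GaugeConfig d L G, ℝ)} (hg : g ∈ polyAlgebra (ι := Edge d L) r) :
    (ψ ∘ₗ gaugeAvgL d L G) (g.comp (relabelCM (edgePerm σ))) = (ψ ∘ₗ gaugeAvgL d L G) g := by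
  rw [LinearMap.comp_apply, LinearMap.comp_apply, gaugeAvgL_comp_edgePerm]
  exact hψ σ _ (gaugeAvgL_mem_polyAlgebra r hg) (isGaugeInvariant_gaugeAvgL g)

omit [SecondCountableTopology G] in
/-- **Consistency: the Wilson expectations are invariant under axis permutations** (every
observable; tree `wilsonExpectation_comp_configPerm`), so the invariance hypotheses of this file are
satisfied by the solution and cost nothing when imposed on a truncation. [folklore] -/
theorem integral_comp_edgePerm_eq_wilson (hρ : Continuous ρ) (β : ℝ) (σ : Equiv.Perm (Fin d))
    (f : C(GaugeConfig d L G, ℝ)) :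
    ∫ U, f (U ∘ edgePerm σ) ∂(wilsonMeasure ρ β) = ∫ U, f U ∂(wilsonMeasure (d := d) (L := L) ρ β) := by
  have h := wilsonExpectation_comp_configPerm (d := d) (L := L) ρ hρ β σ.symm f
  simp only [Literature.MathematicalPhysics.QuantumFieldTheory.wilsonExpectation, Function.comp_apply] at h
  simp_rw [← relabelCM_edgePerm_eq_configPerm, coe_relabelCM] at h
  exact h

end Torus

/-! ## `SU(N)` and `U(N)`: the bootstrap with the loop equations at one link -/

section Unitary

open Literature.MathematicalPhysics.QuantumLattice

variable {d L : ℕ}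

/-- ★★★ **`SU(N)` on `(ℤ/L)^d`, ANY real `β`: the loop equations at ONE LINK suffice for a
lattice-invariant functional.** A linear functional invariant on the polynomials under all
translations and axis permutations which satisfies the loop equations at the link `(0, 0)` (all
`X ∈ 𝔰𝔲(N)`, all polynomial test functions) satisfies them at every link. [folklore] -/
theorem isSDFunctional_of_latticeInvariant_oneLink_suN [NeZero L] [NeZero d] (N : ℕ) (β : ℝ)
    {φ : C(GaugeConfig d L (Matrix.specialUnitaryGroup (Fin N) ℂ), ℝ) →ₗ[ℝ] ℝ}
    (hφt : ∀ (a : Site d L), ∀ g ∈ polyAlgebra (ι := Edge d L) (fundamentalLatticeRep N),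
      φ (g.comp (relabelCM (translateEquiv a))) = φ g)
    (hφp : ∀ (σ : Equiv.Perm (Fin d)), ∀ g ∈ polyAlgebra (ι := Edge d L) (fundamentalLatticeRep N),
      φ (g.comp (relabelCM (edgePerm σ))) = φ g)
    (hrows : IsSDFunctionalAt (fundamentalLatticeRep N) {(((0 : Site d L)), (0 : Fin d))}
      (suExp N) (fun _ => wilsonAction (fundamentalRep (Fin N))) β φ) :
    IsSDFunctional (fundamentalLatticeRep N) (suExp N) (fun _ => wilsonAction (fundamentalRep (Fin N))) β φ :=
  isSDFunctional_of_latticeInvariant_oneLink (fundamentalRep (Fin N)) (fundamentalLatticeRep N)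
    (continuous_fundamentalRep _) (suExp_add N)
    (X := fun X : SuGenerator N => (X : Matrix (Fin N) (Fin N) ℂ)) (rho_suExp N) hφt hφp hrows

/-- ★★★ **`U(N)`: the loop equations at one link suffice for a lattice-invariant functional.**
[folklore] -/
theorem isSDFunctional_of_latticeInvariant_oneLink_uN [NeZero L] [NeZero d] (N : ℕ) (β : ℝ)
    {φ : C(GaugeConfig d L (Matrix.unitaryGroup (Fin N) ℂ), ℝ) →ₗ[ℝ] ℝ}
    (hφt : ∀ (a : Site d L), ∀ g ∈ polyAlgebra (ι := Edge d L) (unitaryFundamentalLatticeRep N),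
      φ (g.comp (relabelCM (translateEquiv a))) = φ g)
    (hφp : ∀ (σ : Equiv.Perm (Fin d)), ∀ g ∈ polyAlgebra (ι := Edge d L) (unitaryFundamentalLatticeRep N),
      φ (g.comp (relabelCM (edgePerm σ))) = φ g)
    (hrows : IsSDFunctionalAt (unitaryFundamentalLatticeRep N) {(((0 : Site d L)), (0 : Fin d))}
      (uExp N) (fun _ => wilsonAction (unitaryFundamentalRep (Fin N) ℂ)) β φ) :
    IsSDFunctional (unitaryFundamentalLatticeRep N) (uExp N)
      (fun _ => wilsonAction (unitaryFundamentalRep (Fin N) ℂ)) β φ :=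
  isSDFunctional_of_latticeInvariant_oneLink (unitaryFundamentalRep (Fin N) ℂ) (unitaryFundamentalLatticeRep N)
    (continuous_unitaryFundamentalRep _ _) (uExp_add N)
    (X := fun X : UGenerator N => (X : Matrix (Fin N) (Fin N) ℂ)) (rho_uExp N) hφt hφp hrows

/-- ★★★ **`SU(N)` on `(ℤ/L)^d`, ANY real `β`: normalisation + square-positivity + lattice
invariance + the loop equations at ONE LINK determine every polynomial expectation** — the
functional IS the Wilson expectation. [folklore] -/
theorem eq_wilson_of_bootstrap_oneLink_suN [NeZero L] [NeZero d] (N : ℕ) (β : ℝ)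
    {φ : C(GaugeConfig d L (Matrix.specialUnitaryGroup (Fin N) ℂ), ℝ) →ₗ[ℝ] ℝ} (h1 : φ 1 = 1)
    (hpos : ∀ a ∈ polyAlgebra (ι := Edge d L) (fundamentalLatticeRep N), 0 ≤ φ (a * a))
    (hφt : ∀ (a : Site d L), ∀ g ∈ polyAlgebra (ι := Edge d L) (fundamentalLatticeRep N),
      φ (g.comp (relabelCM (translateEquiv a))) = φ g)
    (hφp : ∀ (σ : Equiv.Perm (Fin d)), ∀ g ∈ polyAlgebra (ι := Edge d L) (fundamentalLatticeRep N),
      φ (g.comp (relabelCM (edgePerm σ))) = φ g)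
    (hrows : IsSDFunctionalAt (fundamentalLatticeRep N) {(((0 : Site d L)), (0 : Fin d))}
      (suExp N) (fun _ => wilsonAction (fundamentalRep (Fin N))) β φ)
    {a : C(GaugeConfig d L (Matrix.specialUnitaryGroup (Fin N) ℂ), ℝ)}
    (ha : a ∈ polyAlgebra (ι := Edge d L) (fundamentalLatticeRep N)) :
    φ a = ∫ U, a U ∂(wilsonMeasure (fundamentalRep (Fin N)) β) :=
  eq_wilson_of_bootstrap_suN N β h1 hpos (isSDFunctional_of_latticeInvariant_oneLink_suN N β hφt hφp hrows) ha

/-- ★★★ **`U(N)`: normalisation + square-positivity + lattice invariance + the loop equations at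
one link determine every polynomial expectation.** [folklore] -/
theorem eq_wilson_of_bootstrap_oneLink_uN [NeZero L] [NeZero d] (N : ℕ) (β : ℝ)
    {φ : C(GaugeConfig d L (Matrix.unitaryGroup (Fin N) ℂ), ℝ) →ₗ[ℝ] ℝ} (h1 : φ 1 = 1)
    (hpos : ∀ a ∈ polyAlgebra (ι := Edge d L) (unitaryFundamentalLatticeRep N), 0 ≤ φ (a * a))
    (hφt : ∀ (a : Site d L), ∀ g ∈ polyAlgebra (ι := Edge d L) (unitaryFundamentalLatticeRep N),
      φ (g.comp (relabelCM (translateEquiv a))) = φ g)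
    (hφp : ∀ (σ : Equiv.Perm (Fin d)), ∀ g ∈ polyAlgebra (ι := Edge d L) (unitaryFundamentalLatticeRep N),
      φ (g.comp (relabelCM (edgePerm σ))) = φ g)
    (hrows : IsSDFunctionalAt (unitaryFundamentalLatticeRep N) {(((0 : Site d L)), (0 : Fin d))}
      (uExp N) (fun _ => wilsonAction (unitaryFundamentalRep (Fin N) ℂ)) β φ)
    {a : C(GaugeConfig d L (Matrix.unitaryGroup (Fin N) ℂ), ℝ)}
    (ha : a ∈ polyAlgebra (ι := Edge d L) (unitaryFundamentalLatticeRep N)) :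
    φ a = ∫ U, a U ∂(wilsonMeasure (unitaryFundamentalRep (Fin N) ℂ) β) :=
  eq_wilson_of_bootstrap_uN N β h1 hpos (isSDFunctional_of_latticeInvariant_oneLink_uN N β hφt hφp hrows) ha

/-- ★★★ **`SU(N)`, the bootstrap on GAUGE-INVARIANT data with the loop equations at ONE LINK.** A
linear `ψ`, invariant on the gauge-invariant polynomials under translations and axis permutations,
with `ψ 1 = 1`, loop positivity `0 ≤ ψ (A (a a))` and the gauge-averaged loop equations at the
single link `(0, 0)`, gives every gauge-invariant polynomial observable its Wilson expectation.
[folklore] -/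
theorem eq_wilson_of_gaugeInvariantBootstrap_oneLink_suN [NeZero L] [NeZero d] (N : ℕ) (β : ℝ)
    {ψ : C(GaugeConfig d L (Matrix.specialUnitaryGroup (Fin N) ℂ), ℝ) →ₗ[ℝ] ℝ} (h1 : ψ 1 = 1)
    (hinvt : ∀ (a : Site d L), ∀ h ∈ polyAlgebra (ι := Edge d L) (fundamentalLatticeRep N),
      IsGaugeInvariant (⇑h) → ψ (h.comp (relabelCM (translateEquiv a))) = ψ h)
    (hinvp : ∀ (σ : Equiv.Perm (Fin d)), ∀ h ∈ polyAlgebra (ι := Edge d L) (fundamentalLatticeRep N),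
      IsGaugeInvariant (⇑h) → ψ (h.comp (relabelCM (edgePerm σ))) = ψ h)
    (hpos : ∀ a ∈ polyAlgebra (ι := Edge d L) (fundamentalLatticeRep N),
      0 ≤ ψ (gaugeAvgL d L _ (a * a)))
    (hrows : IsSDFunctionalAt (fundamentalLatticeRep N) {(((0 : Site d L)), (0 : Fin d))}
      (suExp N) (fun _ => wilsonAction (fundamentalRep (Fin N))) β (ψ ∘ₗ gaugeAvgL d L _))
    {a : C(GaugeConfig d L (Matrix.specialUnitaryGroup (Fin N) ℂ), ℝ)}
    (ha : a ∈ polyAlgebra (ι := Edge d L) (fundamentalLatticeRep N)) (hai : IsGaugeInvariant (⇑a)) :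
    ψ a = ∫ U, a U ∂(wilsonMeasure (fundamentalRep (Fin N)) β) :=
  eq_wilson_of_gaugeInvariantBootstrap_suN N β h1 hpos
    (isSDFunctional_of_latticeInvariant_oneLink_suN N β
      (fun b _ hg => comp_gaugeAvgL_translationInvariant _ hinvt b hg)
      (fun σ _ hg => comp_gaugeAvgL_permInvariant _ hinvp σ hg) hrows) ha hai

/-- ★★★ **`U(N)`, the bootstrap on gauge-invariant data with the loop equations at one link.**
[folklore] -/
theorem eq_wilson_of_gaugeInvariantBootstrap_oneLink_uN [NeZero L] [NeZero d] (N : ℕ) (β : ℝ)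
    {ψ : C(GaugeConfig d L (Matrix.unitaryGroup (Fin N) ℂ), ℝ) →ₗ[ℝ] ℝ} (h1 : ψ 1 = 1)
    (hinvt : ∀ (a : Site d L), ∀ h ∈ polyAlgebra (ι := Edge d L) (unitaryFundamentalLatticeRep N),
      IsGaugeInvariant (⇑h) → ψ (h.comp (relabelCM (translateEquiv a))) = ψ h)
    (hinvp : ∀ (σ : Equiv.Perm (Fin d)), ∀ h ∈ polyAlgebra (ι := Edge d L) (unitaryFundamentalLatticeRep N),
      IsGaugeInvariant (⇑h) → ψ (h.comp (relabelCM (edgePerm σ))) = ψ h)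
    (hpos : ∀ a ∈ polyAlgebra (ι := Edge d L) (unitaryFundamentalLatticeRep N),
      0 ≤ ψ (gaugeAvgL d L _ (a * a)))
    (hrows : IsSDFunctionalAt (unitaryFundamentalLatticeRep N) {(((0 : Site d L)), (0 : Fin d))}
      (uExp N) (fun _ => wilsonAction (unitaryFundamentalRep (Fin N) ℂ)) β (ψ ∘ₗ gaugeAvgL d L _))
    {a : C(GaugeConfig d L (Matrix.unitaryGroup (Fin N) ℂ), ℝ)}
    (ha : a ∈ polyAlgebra (ι := Edge d L) (unitaryFundamentalLatticeRep N)) (hai : IsGaugeInvariant (⇑a)) :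
    ψ a = ∫ U, a U ∂(wilsonMeasure (unitaryFundamentalRep (Fin N) ℂ) β) :=
  eq_wilson_of_gaugeInvariantBootstrap_uN N β h1 hpos
    (isSDFunctional_of_latticeInvariant_oneLink_uN N β
      (fun b _ hg => comp_gaugeAvgL_translationInvariant _ hinvt b hg)
      (fun σ _ hg => comp_gaugeAvgL_permInvariant _ hinvp σ hg) hrows) ha hai

/-- **Consistency (`SU(N)`)**: the Wilson expectation functional is invariant under axis
permutations on every observable, so `hφp` / `hinvp` above are satisfied by the solution. -/
theorem wilson_permInvariant_suN [NeZero L] (N : ℕ) (β : ℝ)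
    (μ : Measure (GaugeConfig d L (Matrix.specialUnitaryGroup (Fin N) ℂ))) [IsProbabilityMeasure μ]
    (hμ : μ = wilsonMeasure (fundamentalRep (Fin N)) β) (σ : Equiv.Perm (Fin d))
    (h : C(GaugeConfig d L (Matrix.specialUnitaryGroup (Fin N) ℂ), ℝ)) :
    expectationFunctional μ (h.comp (relabelCM (edgePerm σ))) = expectationFunctional μ h := by
  subst hμ
  rw [expectationFunctional_apply, expectationFunctional_apply]
  exact integral_comp_edgePerm_eq_wilson (fundamentalRep (Fin N)) (continuous_fundamentalRep _) β σ h

end Unitary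

end Summit.QuantumFields.GaugeBoot

end
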